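import Summits.ABC.IUTFork.Conditional.AbcOfSlotLicenceGenuineM
import Summits.ABC.IUTFork.Cor312ThetaSlotExactM
import HarnessLib

/-!
# Branch C, M line, READING (P) — EVEN revision of `AbcOfSlotLicenceGenuineM.lean` (p468614): the READ-P-M binder DISCHARGED BY NAME by abc-iut-C-cert-2's
# M-LEVEL SLOT READ (`Cor312ThetaSlotExactM`, p469199) ⇒ the M-line γ certificates at EXPLICIT 1 · CONE 0 · READ 0 · PIN 0 · SIDE 0 · PROV 0
# (M twin of abc-iut-C-cert-2's γ COMPANION OF RECORD `abc_of_slotLicence_orNumP_K_content_read`, p462946, C-R49)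

C scoreboard (abc-iut-C-cert-1 gen 5, EVEN-revision writer). PROOF-ONLY (no `def`, no new `Prop`, no instance, no notation; nothing re-typed; p468614's
section variables and binder texts VERBATIM). abc-iut-C-cert-2 gen 4's `negLogThetaSlot_settingPrVolSharpM_le_negLogThetaPerImage_of_isVolumeInputOf`
(p469199; parts p467620 / p467926: at the summand-route M-level sharp setting of a volume input's OWN Θ-ideles, for ANY non-zero `q`-ideles that are units off a
finite set, `−|log(Θ)|_(P) = ↑I.negLogThetaPerImageNonarch ≤ ↑I.negLogThetaPerImage`, UNCONDITIONAL) read at a genuine Θ-volume DATUM `T` (`I := T.I`,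
`hI := T.isVolumeInputOf`, the M books' `q`-ideles `tqM … (ideleDataOf T.D T.isVolumeInputOf)`) IS the binder `hReadP` of p468614 — LITERALLY:

* `GenuineMSlot.negLogThetaSlot_le_datum` — per datum, `hReadP`'s body as a theorem (one application of p469199);
* `GenuineMSlot.cor312PerImageOf_of_slotLicence_read` / `…_of_slotStatement_read` — p468614's per-datum lemmas with the READ folded;
* **`abc_of_slotLicence_orNumP_M_szpiroBad_read`** [hNumPOffBad_M] · **`abc_of_slotLicence_orNumP_M_content_read`** [hNumPOffC_M] (θ-cut) ·
  `abc_of_slotStatement_genuineM_szpiroBad_read` [hstPBad_M] — p468614's three certificates with `hReadP` instantiated: EXPLICIT 1 each; CONE 0 · READ 0 ·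
  PIN 0 · SIDE 0 · PROV 0. The M line thereby carries a reading-(P) companion at the K γ record's count (p462946: 1).

HONEST STRENGTH (numbers, not adjectives; unchanged from p468614 / the K twins): `hNumPOffC` is consumed at NO admissible `(P, l)` with `log q^{∤{2,l}}(λ) ≤
120·d*_mod·l` (`≥ 4.6·10⁸` nats) — at no known or tabulated datum; `hNumPOffBad` only at Szpiro-bad admissible data where the M-level slot licence fails; where
consumed they are neither instantiated nor refuted; `SlotLicence` is STRONGER than print's hull of the union (p. 184 l. 26–29). HONEST FRAMING: locates /
conditionally verifies; nothing here asserts that abc is proved or refuted, or that [IUTchIII] Cor. 3.12 / Thm. 3.11 or [IUTchIV] Thm. 1.10 holds or fails at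
any datum, or takes a side on any author (Mochizuki / Scholze–Stix / Joshi / Dupuy–Hilado) or on the (U)/(P) reading; the remaining binders are assumption
labels, never asserted; a fold discharges only OUR typed READ identity, not the disputed inequality; typed ≠ proved; instantiated ≠ endorsed; refuted-as-typed ≠
refuted-in-print. [claim: Mochizuki2012, status: disputed]
[cite: Mochizuki2012, IUTchIII Cor. 3.12 p. 173–174, Step (x) p. 181, Step (xi-f) p. 184; IUTchIV Thm. 1.10 p. 22–31 (Step (vii) p. 30), Cor. 2.2 (ii)–(iii) p. 43–47]
[cite: Mochizuki2012, IUTchI Def. 3.1 (e) p. 62] [cite: DupuyHilado2025, §1 (1.1), §3.3, §3.9, §4.10–4.12]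
-/

noncomputable section

open Set Function NumberField IsDedekindDomain

namespace Summit.ABC.IUTFork.Conditional

open Thm311 Thm311.Real Cor312 Cor312Vol Cor312Prov Literature.IUT.LogThetaLattice Literature.IUT.LogVolume
  Literature.IUT.HodgeTheaters Literature.IUT.LogVolume.ThetaData Literature.NumberTheory.NumberFields
open Literature.NumberTheory.DiophantineGeometry.GenEll Summit.ABC.ABC.Theorems

section Family

/-! ## §1 DATA — p468614's section variables VERBATIM (the M books' γ-relevant columns) -/

variable
    (M : ∀ (P : NFPoint) (l : ℕ) (T : Cor22.ThetaVolumeDatumAt P l), Type) [∀ P l T, Field (M P l T)] [∀ P l T, NumberField (M P l T)]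
    (archPk : ∀ (P : NFPoint) (l : ℕ) (T : Cor22.ThetaVolumeDatumAt P l), letI := T.instFieldF; letI := T.instNumberFieldF; letI := T.instAlgebraF; letI := T.instFieldK;
        letI := T.instNumberFieldK; letI := T.instAlgebraK; letI := T.instFieldFbar; letI := T.instAlgebraFbar;
        letI := T.instAlgebraKFbar; letI := T.instIsElliptic;
      ∀ (j : (thetaIndexOfInitial T.D).Label) (vQ : (thetaIndexOfInitial T.D).VQ), Set ((logShellsOfInitialDH T.D (analyticLogvVal T.K)).Packet j vQ))
    (archSub : ∀ (P : NFPoint) (l : ℕ) (T : Cor22.ThetaVolumeDatumAt P l), letI := T.instFieldF; letI := T.instNumberFieldF; letI := T.instAlgebraF; letI := T.instFieldK;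
        letI := T.instNumberFieldK; letI := T.instAlgebraK; letI := T.instFieldFbar; letI := T.instAlgebraFbar;
        letI := T.instAlgebraKFbar; letI := T.instIsElliptic;
      ∀ (j : (thetaIndexOfInitial T.D).Label) (v : (thetaIndexOfInitial T.D).V), Set ((logShellsOfInitialDH T.D (analyticLogvVal T.K)).Packet j ((thetaIndexOfInitial T.D).over v)))
    (Ψ : ∀ (P : NFPoint) (l : ℕ) (T : Cor22.ThetaVolumeDatumAt P l), letI := T.instFieldF; letI := T.instNumberFieldF; letI := T.instAlgebraF; letI := T.instFieldK;
        letI := T.instNumberFieldK; letI := T.instAlgebraK; letI := T.instFieldFbar; letI := T.instAlgebraFbar;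
        letI := T.instAlgebraKFbar; letI := T.instIsElliptic;
      ℤ → ∀ v : (thetaIndexOfInitial T.D).V, v ∈ (thetaIndexOfInitial T.D).Vbad → Set ((logShellsOfInitialDH T.D (analyticLogvVal T.K)).StarPacket v))
    (act : ∀ (P : NFPoint) (l : ℕ) (T : Cor22.ThetaVolumeDatumAt P l), letI := T.instFieldF; letI := T.instNumberFieldF; letI := T.instAlgebraF; letI := T.instFieldK;
        letI := T.instNumberFieldK; letI := T.instAlgebraK; letI := T.instFieldFbar; letI := T.instAlgebraFbar;
        letI := T.instAlgebraKFbar; letI := T.instIsElliptic;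
      ℤ → ∀ v : (thetaIndexOfInitial T.D).V, v ∈ (thetaIndexOfInitial T.D).Vbad → (logShellsOfInitialDH T.D (analyticLogvVal T.K)).StarPacket v → Module.End ℚ ((logShellsOfInitialDH T.D (analyticLogvVal T.K)).StarPacket v))
    (Mmod : ∀ (P : NFPoint) (l : ℕ) (T : Cor22.ThetaVolumeDatumAt P l), letI := T.instFieldF; letI := T.instNumberFieldF; letI := T.instAlgebraF; letI := T.instFieldK;
        letI := T.instNumberFieldK; letI := T.instAlgebraK; letI := T.instFieldFbar; letI := T.instAlgebraFbar;
        letI := T.instAlgebraKFbar; letI := T.instIsElliptic;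
      ℤ → ∀ j : (thetaIndexOfInitial T.D).LabelStar, Set ((logShellsOfInitialDH T.D (analyticLogvVal T.K)).GlobalPacket j.1))
    (region : ∀ (P : NFPoint) (l : ℕ) (T : Cor22.ThetaVolumeDatumAt P l), letI := T.instFieldF; letI := T.instNumberFieldF; letI := T.instAlgebraF; letI := T.instFieldK;
        letI := T.instNumberFieldK; letI := T.instAlgebraK; letI := T.instFieldFbar; letI := T.instAlgebraFbar;
        letI := T.instAlgebraKFbar; letI := T.instIsElliptic;
      ℤ → ∀ j : (thetaIndexOfInitial T.D).LabelStar, FinDivisor (M P l T) → ∀ vQ : (thetaIndexOfInitial T.D).VQ, Set ((logShellsOfInitialDH T.D (analyticLogvVal T.K)).Packet j.1 vQ))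
    (n : ∀ (P : NFPoint) (l : ℕ) (T : Cor22.ThetaVolumeDatumAt P l), ℤ)
    {HT : ∀ (P : NFPoint) (l : ℕ) (T : Cor22.ThetaVolumeDatumAt P l), Type} {LogLink : ∀ (P : NFPoint) (l : ℕ) (T : Cor22.ThetaVolumeDatumAt P l), HT P l T → HT P l T → Type}
    {IsFull : ∀ (P : NFPoint) (l : ℕ) (T : Cor22.ThetaVolumeDatumAt P l), ∀ {s t : HT P l T}, LogLink P l T s t → Prop}
    (lat : ∀ (P : NFPoint) (l : ℕ) (T : Cor22.ThetaVolumeDatumAt P l), LGPGaussianLogThetaLattice (LogLink P l T) (IsFull P l T))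
    {Frd : ∀ (P : NFPoint) (l : ℕ) (T : Cor22.ThetaVolumeDatumAt P l), Type} {IsoF : ∀ (P : NFPoint) (l : ℕ) (T : Cor22.ThetaVolumeDatumAt P l), Frd P l T → Frd P l T → Type} {Ob : ∀ (P : NFPoint) (l : ℕ) (T : Cor22.ThetaVolumeDatumAt P l), Frd P l T → Type}
    {realify : ∀ (P : NFPoint) (l : ℕ) (T : Cor22.ThetaVolumeDatumAt P l), Frd P l T → Frd P l T} {Strip : ∀ (P : NFPoint) (l : ℕ) (T : Cor22.ThetaVolumeDatumAt P l), Type} {IsoS : ∀ (P : NFPoint) (l : ℕ) (T : Cor22.ThetaVolumeDatumAt P l), Strip P l T → Strip P l T → Type}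
    {Mv : ∀ (P : NFPoint) (l : ℕ) (T : Cor22.ThetaVolumeDatumAt P l), letI := T.instFieldF; letI := T.instNumberFieldF; letI := T.instAlgebraF; letI := T.instFieldK;
        letI := T.instNumberFieldK; letI := T.instAlgebraK; letI := T.instFieldFbar; letI := T.instAlgebraFbar;
        letI := T.instAlgebraKFbar; letI := T.instIsElliptic;
      ∀ v : (thetaIndexOfInitial T.D).V, v ∈ (thetaIndexOfInitial T.D).Vbad → Type}
    [∀ P l T v h, Monoid (Mv P l T v h)]
    (sig : ∀ (P : NFPoint) (l : ℕ) (T : Cor22.ThetaVolumeDatumAt P l), letI := T.instFieldF; letI := T.instNumberFieldF; letI := T.instAlgebraF; letI := T.instFieldK;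
        letI := T.instNumberFieldK; letI := T.instAlgebraK; letI := T.instFieldFbar; letI := T.instAlgebraFbar;
        letI := T.instAlgebraKFbar; letI := T.instIsElliptic;
      GlobalLGPFrobenioidSignature (thetaIndexOfInitial T.D).lstar (thetaIndexOfInitial T.D).V (· ∈ (thetaIndexOfInitial T.D).Vbad) (Frd P l T) (IsoF P l T) (Ob P l T) (realify P l T)
        (Strip P l T) (IsoS P l T) (Mv P l T))
    (split : ∀ (P : NFPoint) (l : ℕ) (T : Cor22.ThetaVolumeDatumAt P l), SplittingMonoids (Mv P l T))
    {ObΔ : ∀ (P : NFPoint) (l : ℕ) (T : Cor22.ThetaVolumeDatumAt P l), Type}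
    {N : ∀ (P : NFPoint) (l : ℕ) (T : Cor22.ThetaVolumeDatumAt P l), letI := T.instFieldF; letI := T.instNumberFieldF; letI := T.instAlgebraF; letI := T.instFieldK;
        letI := T.instNumberFieldK; letI := T.instAlgebraK; letI := T.instFieldFbar; letI := T.instAlgebraFbar;
        letI := T.instAlgebraKFbar; letI := T.instIsElliptic;
      ∀ v : (thetaIndexOfInitial T.D).V, v ∈ (thetaIndexOfInitial T.D).Vbad → Type}
    [∀ P l T v h, Monoid (N P l T v h)] (qData : ∀ (P : NFPoint) (l : ℕ) (T : Cor22.ThetaVolumeDatumAt P l), QPilotData (ObΔ P l T) (N P l T))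

/-! ## §2 Per datum: the READ-P-M binder as a theorem, and p468614's per-datum lemmas with it folded -/

/-- **READ-P-M at the datum, BY NAME**: the body of p468614's binder `hReadP` at a genuine Θ-volume datum `T` — abc-iut-C-cert-2's
`negLogThetaSlot_settingPrVolSharpM_le_negLogThetaPerImage_of_isVolumeInputOf` (p469199) at `I := T.I`, `hI := T.isVolumeInputOf`, the M books' `q`-ideles.
Nothing else. [cite: Mochizuki2012, IUTchIII Cor. 3.12 proof Step (x) p. 181; IUTchIV Thm. 1.10 Step (vii) p. 30] [claim: Mochizuki2012, status: disputed] -/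
theorem GenuineMSlot.negLogThetaSlot_le_datum {P : NFPoint} {l : ℕ} (T : Cor22.ThetaVolumeDatumAt P l) :
    letI := T.instFieldF; letI := T.instNumberFieldF; letI := T.instAlgebraF; letI := T.instFieldK;
        letI := T.instNumberFieldK; letI := T.instAlgebraK; letI := T.instFieldFbar; letI := T.instAlgebraFbar;
        letI := T.instAlgebraKFbar; letI := T.instIsElliptic;
    (settingPrVolSharpM T.D (logvAnalyticVal_analyticLogvVal (K := T.K)) (tOfIdeleData T.D (ideleDataOf T.D T.isVolumeInputOf))
          (fun u x => tqM T.D (ratChar u) u (natCast_ratChar_mem u) (ideleDataOf T.D T.isVolumeInputOf) x)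
          (M P l T) (archPk P l T) (archSub P l T) (Ψ P l T) (act P l T)
          (Mmod P l T) (region P l T) (n P l T) (lat P l T) (sig P l T) (split P l T) (qData P l T)
          (fun u x => tqM_ne_zero T.D (ratChar u) u (natCast_ratChar_mem u) (ideleDataOf T.D T.isVolumeInputOf) x)
          (GenuineM.finite_ratPlaces_under_S T.D).toFinset
          (fun u x hu => norm_tqM_eq_one_of_not_mem T.D (ratChar u) u (natCast_ratChar_mem u) (ideleDataOf T.D T.isVolumeInputOf) x
            fun hx => hu ((Set.Finite.mem_toFinset _).mpr ⟨x, hx⟩))).negLogThetaSlot ≤ ((T.negLogThetaPerImage : ℝ) : WithTop ℝ) := by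
  letI := T.instFieldF; letI := T.instNumberFieldF; letI := T.instAlgebraF; letI := T.instFieldK
  letI := T.instNumberFieldK; letI := T.instAlgebraK; letI := T.instFieldFbar; letI := T.instAlgebraFbar
  letI := T.instAlgebraKFbar; letI := T.instIsElliptic
  exact (negLogThetaSlot_settingPrVolSharpM_le_negLogThetaPerImage_of_isVolumeInputOf T.D (logvAnalyticVal_analyticLogvVal (K := T.K))
      (fun u x => tqM T.D (ratChar u) u (natCast_ratChar_mem u) (ideleDataOf T.D T.isVolumeInputOf) x)
      (M P l T) (archPk P l T) (archSub P l T) (Ψ P l T) (act P l T) (Mmod P l T) (region P l T) (n P l T) (lat P l T) (sig P l T) (split P l T) (qData P l T)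
      (fun u x => tqM_ne_zero T.D (ratChar u) u (natCast_ratChar_mem u) (ideleDataOf T.D T.isVolumeInputOf) x)
      (GenuineM.finite_ratPlaces_under_S T.D).toFinset
      (fun u x hu => norm_tqM_eq_one_of_not_mem T.D (ratChar u) u (natCast_ratChar_mem u) (ideleDataOf T.D T.isVolumeInputOf) x
        fun hx => hu ((Set.Finite.mem_toFinset _).mpr ⟨x, hx⟩))
      T.isVolumeInputOf)

/-- **Per datum, reading (P), M level, READ folded: `SlotLicence` ⟹ `T.Cor312PerImageOf`** (p468614's `GenuineMSlot.cor312PerImageOf_of_slotLicence` with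
`hread := GenuineMSlot.negLogThetaSlot_le_datum`). Nothing asserted about the licence. [claim: Mochizuki2012, status: disputed]
[cite: Mochizuki2012, IUTchIII Cor. 3.12 Step (xi-f) p. 184] -/
theorem GenuineMSlot.cor312PerImageOf_of_slotLicence_read {P : NFPoint} {l : ℕ} (T : Cor22.ThetaVolumeDatumAt P l)
    (hlic : letI := T.instFieldF; letI := T.instNumberFieldF; letI := T.instAlgebraF; letI := T.instFieldK;
        letI := T.instNumberFieldK; letI := T.instAlgebraK; letI := T.instFieldFbar; letI := T.instAlgebraFbar;
        letI := T.instAlgebraKFbar; letI := T.instIsElliptic;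
      (settingPrVolSharpM T.D (logvAnalyticVal_analyticLogvVal (K := T.K)) (tOfIdeleData T.D (ideleDataOf T.D T.isVolumeInputOf))
          (fun u x => tqM T.D (ratChar u) u (natCast_ratChar_mem u) (ideleDataOf T.D T.isVolumeInputOf) x)
          (M P l T) (archPk P l T) (archSub P l T) (Ψ P l T) (act P l T)
          (Mmod P l T) (region P l T) (n P l T) (lat P l T) (sig P l T) (split P l T) (qData P l T)
          (fun u x => tqM_ne_zero T.D (ratChar u) u (natCast_ratChar_mem u) (ideleDataOf T.D T.isVolumeInputOf) x)
          (GenuineM.finite_ratPlaces_under_S T.D).toFinset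
          (fun u x hu => norm_tqM_eq_one_of_not_mem T.D (ratChar u) u (natCast_ratChar_mem u) (ideleDataOf T.D T.isVolumeInputOf) x
            fun hx => hu ((Set.Finite.mem_toFinset _).mpr ⟨x, hx⟩))).SlotLicence) :
    T.Cor312PerImageOf :=
  GenuineMSlot.cor312PerImageOf_of_slotLicence M archPk archSub Ψ act Mmod region n lat sig split qData T hlic
    (GenuineMSlot.negLogThetaSlot_le_datum M archPk archSub Ψ act Mmod region n lat sig split qData T)

/-- **Per datum, reading (P), M level, READ folded: `SlotStatement` ⟹ `T.Cor312PerImageOf`**. Nothing asserted about the statement.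
[claim: Mochizuki2012, status: disputed] [cite: Mochizuki2012, IUTchIII Cor. 3.12 p. 174] -/
theorem GenuineMSlot.cor312PerImageOf_of_slotStatement_read {P : NFPoint} {l : ℕ} (T : Cor22.ThetaVolumeDatumAt P l)
    (hst : letI := T.instFieldF; letI := T.instNumberFieldF; letI := T.instAlgebraF; letI := T.instFieldK;
        letI := T.instNumberFieldK; letI := T.instAlgebraK; letI := T.instFieldFbar; letI := T.instAlgebraFbar;
        letI := T.instAlgebraKFbar; letI := T.instIsElliptic;
      (settingPrVolSharpM T.D (logvAnalyticVal_analyticLogvVal (K := T.K)) (tOfIdeleData T.D (ideleDataOf T.D T.isVolumeInputOf))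
          (fun u x => tqM T.D (ratChar u) u (natCast_ratChar_mem u) (ideleDataOf T.D T.isVolumeInputOf) x)
          (M P l T) (archPk P l T) (archSub P l T) (Ψ P l T) (act P l T)
          (Mmod P l T) (region P l T) (n P l T) (lat P l T) (sig P l T) (split P l T) (qData P l T)
          (fun u x => tqM_ne_zero T.D (ratChar u) u (natCast_ratChar_mem u) (ideleDataOf T.D T.isVolumeInputOf) x)
          (GenuineM.finite_ratPlaces_under_S T.D).toFinset
          (fun u x hu => norm_tqM_eq_one_of_not_mem T.D (ratChar u) u (natCast_ratChar_mem u) (ideleDataOf T.D T.isVolumeInputOf) x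
            fun hx => hu ((Set.Finite.mem_toFinset _).mpr ⟨x, hx⟩))).SlotStatement) :
    T.Cor312PerImageOf :=
  GenuineMSlot.cor312PerImageOf_of_slotStatement M archPk archSub Ψ act Mmod region n lat sig split qData T hst
    (GenuineMSlot.negLogThetaSlot_le_datum M archPk archSub Ψ act Mmod region n lat sig split qData T)

/-! ## §3 The M-line γ certificates at EXPLICIT 1 -/

/-- **`abc_of_slotLicence_orNumP_M_szpiroBad_read`** — the M-line γ certificate (p468614) with READ-P-M DISCHARGED (p469199): `ABC` from the ONE hypothesis
[NUM-P-OFF-M, Szpiro-bad] `hNumPOffBad` «at every admissible SZPIRO-BAD `(P, l)` and genuine `T` where OUR SLOT licence fails at the summand-route M-level sharp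
setting of the datum's own ideles, `T.Cor312PerImageOf`». EXPLICIT 1 · CONE 0 · READ 0 · PIN 0 · SIDE 0 · PROV 0. «`ABC` follows from this hypothesis as typed» —
no side taken on [IUTchIII] Cor. 3.12, [IUTchIV] Thm. 1.10 or on (U)/(P); typed ≠ proved; instantiated ≠ endorsed. [claim: Mochizuki2012, status: disputed]
[cite: DupuyHilado2025, §4.12] -/
theorem abc_of_slotLicence_orNumP_M_szpiroBad_read
    (hNumPOffBad : ∀ (P : NFPoint), P ∈ UP → ∀ (l : ℕ), l.Prime → 5 ≤ l →
      Cor22.AdmitsCore P → Cor22.CondP2 P l → Cor22.CondP5 P l → Cor22.CondP6 P l →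
      (((l : ℝ) + 5) / 4 < (Cor22.dmod P : ℝ) ∨
        6 * l * (((l : ℝ) + 5) - 4 * Cor22.dmod P) / (((l : ℝ) + 4) * ((l : ℝ) - 3))
            * (P.logDiff + (1 - 1 / (l : ℝ)) * Cor22.logCondAvoid P {2, l})
          + 6 * l * ((l : ℝ) + 5) / (((l : ℝ) + 4) * ((l : ℝ) - 3)) * Real.log Real.pi < Cor22.logQAvoid P {2, l}) →
      ∀ (T : Cor22.ThetaVolumeDatumAt P l), letI := T.instFieldF; letI := T.instNumberFieldF; letI := T.instAlgebraF; letI := T.instFieldK;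
        letI := T.instNumberFieldK; letI := T.instAlgebraK; letI := T.instFieldFbar; letI := T.instAlgebraFbar;
        letI := T.instAlgebraKFbar; letI := T.instIsElliptic;
      ¬ (settingPrVolSharpM T.D (logvAnalyticVal_analyticLogvVal (K := T.K)) (tOfIdeleData T.D (ideleDataOf T.D T.isVolumeInputOf))
          (fun u x => tqM T.D (ratChar u) u (natCast_ratChar_mem u) (ideleDataOf T.D T.isVolumeInputOf) x)
          (M P l T) (archPk P l T) (archSub P l T) (Ψ P l T) (act P l T)
          (Mmod P l T) (region P l T) (n P l T) (lat P l T) (sig P l T) (split P l T) (qData P l T)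
          (fun u x => tqM_ne_zero T.D (ratChar u) u (natCast_ratChar_mem u) (ideleDataOf T.D T.isVolumeInputOf) x)
          (GenuineM.finite_ratPlaces_under_S T.D).toFinset
          (fun u x hu => norm_tqM_eq_one_of_not_mem T.D (ratChar u) u (natCast_ratChar_mem u) (ideleDataOf T.D T.isVolumeInputOf) x
            fun hx => hu ((Set.Finite.mem_toFinset _).mpr ⟨x, hx⟩))).SlotLicence → T.Cor312PerImageOf)
    : _root_.ABC :=
  abc_of_slotLicence_orNumP_M_szpiroBad M archPk archSub Ψ act Mmod region n lat sig split qData hNumPOffBad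
    fun _ _ T => GenuineMSlot.negLogThetaSlot_le_datum M archPk archSub Ψ act Mmod region n lat sig split qData T

/-- **`abc_of_slotLicence_orNumP_M_content_read`** — the θ-cut M-line γ certificate (p468614) with READ-P-M DISCHARGED: `ABC` from the ONE hypothesis
[NUM-P-OFF-M, content] `hNumPOffC` «at every admissible `(P, l)` ON THE CONTENT LOCUS of [IUTchIV] Thm. 1.10's display and every genuine `T` where OUR SLOT
licence fails at the M-level setting, `T.Cor312PerImageOf`». M twin of the γ COMPANION OF RECORD p462946. EXPLICIT 1 · CONE 0 · READ 0 · PIN 0 · SIDE 0 · PROV 0;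
consumed at NO point with `log q^{∤{2,l}}(λ) ≤ 120·d*_mod·l`, hence at no known point. «`ABC` follows from this hypothesis as typed» — no side taken; typed ≠
proved; instantiated ≠ endorsed. [claim: Mochizuki2012, status: disputed] [cite: Mochizuki2012, IUTchIV Thm. 1.10 p. 22–23, Step (viii) p. 30] -/
theorem abc_of_slotLicence_orNumP_M_content_read
    (hNumPOffC : ∀ (P : NFPoint), P ∈ UP → ∀ (l : ℕ), l.Prime → 5 ≤ l →
      Cor22.AdmitsCore P → Cor22.CondP2 P l → Cor22.CondP5 P l → Cor22.CondP6 P l →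
      6 * ((1 + 20 * (Cor22.dmod P : ℝ) / l) * (P.logDiff + Cor22.logCondAvoid P {2, l}))
          + 120 * (2 ^ 12 * 3 ^ 3 * 5 * (Cor22.dmod P : ℝ) * l) < Cor22.logQAvoid P {2, l} →
      ∀ (T : Cor22.ThetaVolumeDatumAt P l), letI := T.instFieldF; letI := T.instNumberFieldF; letI := T.instAlgebraF; letI := T.instFieldK;
        letI := T.instNumberFieldK; letI := T.instAlgebraK; letI := T.instFieldFbar; letI := T.instAlgebraFbar;
        letI := T.instAlgebraKFbar; letI := T.instIsElliptic;
      ¬ (settingPrVolSharpM T.D (logvAnalyticVal_analyticLogvVal (K := T.K)) (tOfIdeleData T.D (ideleDataOf T.D T.isVolumeInputOf))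
          (fun u x => tqM T.D (ratChar u) u (natCast_ratChar_mem u) (ideleDataOf T.D T.isVolumeInputOf) x)
          (M P l T) (archPk P l T) (archSub P l T) (Ψ P l T) (act P l T)
          (Mmod P l T) (region P l T) (n P l T) (lat P l T) (sig P l T) (split P l T) (qData P l T)
          (fun u x => tqM_ne_zero T.D (ratChar u) u (natCast_ratChar_mem u) (ideleDataOf T.D T.isVolumeInputOf) x)
          (GenuineM.finite_ratPlaces_under_S T.D).toFinset
          (fun u x hu => norm_tqM_eq_one_of_not_mem T.D (ratChar u) u (natCast_ratChar_mem u) (ideleDataOf T.D T.isVolumeInputOf) x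
            fun hx => hu ((Set.Finite.mem_toFinset _).mpr ⟨x, hx⟩))).SlotLicence → T.Cor312PerImageOf)
    : _root_.ABC :=
  abc_of_slotLicence_orNumP_M_content M archPk archSub Ψ act Mmod region n lat sig split qData hNumPOffC
    fun _ _ T => GenuineMSlot.negLogThetaSlot_le_datum M archPk archSub Ψ act Mmod region n lat sig split qData T

/-- **`abc_of_slotStatement_genuineM_szpiroBad_read`** — the M-line (P)-STATEMENT line (p468614) with READ-P-M DISCHARGED: `ABC` from the ONE hypothesis
[C312-P-M, Szpiro-bad] `hstPBad` «`SlotStatement` of the summand-route M-level sharp setting of the datum's own ideles at every admissible SZPIRO-BAD `(P, l)` and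
genuine `T`». EXPLICIT 1 · CONE 0 · READ 0 · PROV 0. «`ABC` follows from this hypothesis as typed» — nothing asserted about it; no side taken on [IUTchIII] Cor. 3.12
or on (U)/(P); typed ≠ proved. [claim: Mochizuki2012, status: disputed] [cite: Mochizuki2012, IUTchIII Cor. 3.12 p. 174] -/
theorem abc_of_slotStatement_genuineM_szpiroBad_read
    (hstPBad : ∀ (P : NFPoint), P ∈ UP → ∀ (l : ℕ), l.Prime → 5 ≤ l →
      Cor22.AdmitsCore P → Cor22.CondP2 P l → Cor22.CondP5 P l → Cor22.CondP6 P l →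
      (((l : ℝ) + 5) / 4 < (Cor22.dmod P : ℝ) ∨
        6 * l * (((l : ℝ) + 5) - 4 * Cor22.dmod P) / (((l : ℝ) + 4) * ((l : ℝ) - 3))
            * (P.logDiff + (1 - 1 / (l : ℝ)) * Cor22.logCondAvoid P {2, l})
          + 6 * l * ((l : ℝ) + 5) / (((l : ℝ) + 4) * ((l : ℝ) - 3)) * Real.log Real.pi < Cor22.logQAvoid P {2, l}) →
      ∀ (T : Cor22.ThetaVolumeDatumAt P l), letI := T.instFieldF; letI := T.instNumberFieldF; letI := T.instAlgebraF; letI := T.instFieldK;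
        letI := T.instNumberFieldK; letI := T.instAlgebraK; letI := T.instFieldFbar; letI := T.instAlgebraFbar;
        letI := T.instAlgebraKFbar; letI := T.instIsElliptic;
      (settingPrVolSharpM T.D (logvAnalyticVal_analyticLogvVal (K := T.K)) (tOfIdeleData T.D (ideleDataOf T.D T.isVolumeInputOf))
          (fun u x => tqM T.D (ratChar u) u (natCast_ratChar_mem u) (ideleDataOf T.D T.isVolumeInputOf) x)
          (M P l T) (archPk P l T) (archSub P l T) (Ψ P l T) (act P l T)
          (Mmod P l T) (region P l T) (n P l T) (lat P l T) (sig P l T) (split P l T) (qData P l T)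
          (fun u x => tqM_ne_zero T.D (ratChar u) u (natCast_ratChar_mem u) (ideleDataOf T.D T.isVolumeInputOf) x)
          (GenuineM.finite_ratPlaces_under_S T.D).toFinset
          (fun u x hu => norm_tqM_eq_one_of_not_mem T.D (ratChar u) u (natCast_ratChar_mem u) (ideleDataOf T.D T.isVolumeInputOf) x
            fun hx => hu ((Set.Finite.mem_toFinset _).mpr ⟨x, hx⟩))).SlotStatement)
    : _root_.ABC :=
  abc_of_slotStatement_genuineM_szpiroBad M archPk archSub Ψ act Mmod region n lat sig split qData hstPBad
    fun _ _ T => GenuineMSlot.negLogThetaSlot_le_datum M archPk archSub Ψ act Mmod region n lat sig split qData T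

end Family

end Summit.ABC.IUTFork.Conditional

end
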